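import Summits.CriticalPhenomena.PercolationContinuityZ3.Theorems.SahiMasterFamilyExplicitMinorDominationSingle

/-!
# One-coordinate gluing, the 0-MINOR side: `Λ = E_3(U¹) + Ψ` when the `0`-minor is a zero flag

Unit `prim-master-conj` (crux anchor stmt-CriticalPhenomena-4575, helper work), gen 19; memo
`run/shared/lean/prim/prim-l12/prim-master-conj/POINTWISE.md` §20.4.  Companion of gen 18's `…CoordinateGluingSandwichApex` (the `1`-minor side,
where `(1−p_e)²E_3(U⁰) ≤ E_3(U)` is a THEOREM).  Here the `0`-minor `P = U^{e←0} = (X, Y, G)` is the zero flag: by the sandwich structure of `Z_3`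
(`…Sandwich`), `G = K ∩ G''` with the four moment relations `μ(XY) = μXμY`, `μ(XG) = κμX`, `μ(YG) = κμY`, `μ(XYG) = κμXμY` (`κ = μK`); the `1`-minor
`Q = U^{e←1} = (A, B, C) ⊇ P` is arbitrary.  By gen 19's single-inequality form (`…ExplicitMinorDominationSingle`), `MD_3` at `(U,e)` — here
`E_3(μ_p;U) ≥ p_e²·E_3(μ_p;U¹)` ("D0_3(2)") — is `Λ := mixC2(P,Q) − E_3(Q) ≥ 0`.

THIS FILE (identities + a conditional reduction; axioms standard):
* `mixC2_sub_sahiE_eq_sahiE_add_psi` — under the four moment relations (any weight `μ`, any `κ`):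
  **`Λ = E_3(Q) + Ψ`**,  `Ψ = ν_0·Cov(Q_1,Q_2) + ν_1·[μ(Q_0Q_2) − μP_0·μQ_2] + ν_2·[μ(Q_0Q_1) − μP_0·μP_1] − (κ − μP_2)·(μP_0·ν_1 + μP_1·ν_0) − ν_0ν_1ν_2`
  (`ν_j = μQ_j − μP_j`); equivalently (`psi_eq_sym`) `Ψ = Σ_i ν_i·Cov(Q_j,Q_k) + μP_2·ν_0ν_1 + μQ_1·ν_0ν_2 + μP_0·ν_1ν_2 − (κ − μP_2)(μP_0ν_1 + μP_1ν_0)`,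
  whose only signed term is the hull term `−(κ − μG)(μX·ν_B + μY·ν_A)` (`κ = μG` kills it: then `Ψ ≥ 0` is three Harris gaps and cells; in general `Ψ` can be negative, see STATUS).
* `sahiE_three_ge_sq_minor_of_psi_nonneg` — for an increasing triple whose `0`-minor satisfies the four relations: `Ψ ≥ 0` and `E_3(U¹) ≥ 0` give
  `MD_3` at `(U, e)`, in particular `p_e²·E_3(μ_p; U^{e←1}) ≤ E_3(μ_p; U)`.
EVIDENCE / STATUS (memo §20.4, corrected 23:40Z): `Λ ≥ 0` (D0_3(2)) holds in every exact test (gen 18 + gen 19, > 10⁴ configurations and 4·10⁶ adversarial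
evaluations), but the split is NOT the mechanism: `Ψ ≥ 0` held in 6,000 random sandwich configurations yet FAILS on the structured family
`X = x₀x₁, Y = x₂x₃, A = {x₀}, B = {x₂}, C = G = X ∪ Y ∪ x₁x₃`, `p = (¼,½,¼,½)`: `Ψ = −1/512` while `Λ = 11/512 > 0` (so `E_3(U¹) = 3/128` is needed) —
the `K = Ω, C = G` core `μ(G|A∖X) + μ(G|B∖Y) ≥ μ(G)` is false in general (`⅛ + ⅛ < ⅜` there).  So `sahiE_three_ge_sq_minor_of_psi_nonneg` is a
SUFFICIENT condition only (it covers e.g. `κ = μ(U^{e←0}_2)`, where `Ψ` is three Harris gaps and cells).  Neither `Ψ` nor `Λ` has a certificate in any cone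
of atoms polynomial in global cell probabilities (kit j141505, j141919).
HONEST FRAMING: identities and a conditional (sufficient-condition) reduction; `Ψ ≥ 0` is FALSE in general, D0_3(2) and `C_3` remain OPEN. [this work]
-/

noncomputable section

open scoped Classical

namespace Summit.CriticalPhenomena.PercolationContinuityZ3.Theorems

open Finset Function
open Literature.Combinatorics.Sahi2008
open Literature.Probability.Percolation.DecisionTree (ind)
open SahiCombMix

namespace Pointwise

variable {ι : Type} [Fintype ι]

/-! ### 1. The identity `Λ = E_3(Q) + Ψ` under the four sandwich moment relations on `P` -/

section Identity

variable (μ : Set ι → ℝ) (P Q : Fin 3 → Set (Set ι)) (κ : ℝ)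
  (h1 : ex μ (ind (P 0) * ind (P 1)) = ex μ (ind (P 0)) * ex μ (ind (P 1)))
  (h2 : ex μ (ind (P 0) * ind (P 2)) = κ * ex μ (ind (P 0)))
  (h3 : ex μ (ind (P 1) * ind (P 2)) = κ * ex μ (ind (P 1)))
  (h4 : ex μ (ind (P 0) * ind (P 1) * ind (P 2)) = κ * ex μ (ind (P 0)) * ex μ (ind (P 1)))
include h1 h2 h3 h4

/-- Under the four sandwich relations the `0`-minor has `E_3(P) = 0` (at this weight). [this work] -/
theorem sahiE_three_eq_zero_of_sandwich_moments : sahiE μ 3 (fun j => ind (P j)) = 0 := by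
  rw [sahiE_three_apply]
  linear_combination (-(ex μ (ind (P 2)))) * h1 - ex μ (ind (P 1)) * h2 - ex μ (ind (P 0)) * h3 + 2 * h4

/-- **`Λ = E_3(Q) + Ψ` on the 0-minor side** (file header): with `p_j = μP_j`, `q_j = μQ_j`, `ν_j = q_j − p_j`,
`mixC2(P,Q) − E_3(Q) = E_3(Q) + ν_0[μ(Q_1Q_2) − q_1q_2] + ν_1[μ(Q_0Q_2) − p_0q_2] + ν_2[μ(Q_0Q_1) − p_0p_1] − (κ − p_2)(p_0ν_1 + p_1ν_0) − ν_0ν_1ν_2`.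
[this work] -/
theorem mixC2_sub_sahiE_eq_sahiE_add_psi :
    mixC2 μ P Q - sahiE μ 3 (fun j => ind (Q j))
      = sahiE μ 3 (fun j => ind (Q j))
        + (ex μ (ind (Q 0)) - ex μ (ind (P 0))) * (ex μ (ind (Q 1) * ind (Q 2)) - ex μ (ind (Q 1)) * ex μ (ind (Q 2)))
        + (ex μ (ind (Q 1)) - ex μ (ind (P 1))) * (ex μ (ind (Q 0) * ind (Q 2)) - ex μ (ind (P 0)) * ex μ (ind (Q 2)))
        + (ex μ (ind (Q 2)) - ex μ (ind (P 2))) * (ex μ (ind (Q 0) * ind (Q 1)) - ex μ (ind (P 0)) * ex μ (ind (P 1)))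
        - (κ - ex μ (ind (P 2))) * (ex μ (ind (P 0)) * (ex μ (ind (Q 1)) - ex μ (ind (P 1)))
                                    + ex μ (ind (P 1)) * (ex μ (ind (Q 0)) - ex μ (ind (P 0))))
        - (ex μ (ind (Q 0)) - ex μ (ind (P 0))) * (ex μ (ind (Q 1)) - ex μ (ind (P 1))) * (ex μ (ind (Q 2)) - ex μ (ind (P 2))) := by
  rw [mixC2, sahiE_three_apply]
  linear_combination (-(ex μ (ind (Q 2)))) * h1 - ex μ (ind (Q 1)) * h2 - ex μ (ind (Q 0)) * h3 + 2 * h4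

omit h1 h2 h3 h4 in
/-- **Symmetric form of `Ψ`**: `Ψ = Σ_i ν_i·Cov(Q_j,Q_k) + p_2·ν_0ν_1 + q_1·ν_0ν_2 + p_0·ν_1ν_2 − (κ − p_2)(p_0ν_1 + p_1ν_0)`
(pure algebra, no hypotheses). [this work] -/
theorem psi_eq_sym :
    (ex μ (ind (Q 0)) - ex μ (ind (P 0))) * (ex μ (ind (Q 1) * ind (Q 2)) - ex μ (ind (Q 1)) * ex μ (ind (Q 2)))
        + (ex μ (ind (Q 1)) - ex μ (ind (P 1))) * (ex μ (ind (Q 0) * ind (Q 2)) - ex μ (ind (P 0)) * ex μ (ind (Q 2)))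
        + (ex μ (ind (Q 2)) - ex μ (ind (P 2))) * (ex μ (ind (Q 0) * ind (Q 1)) - ex μ (ind (P 0)) * ex μ (ind (P 1)))
        - (κ - ex μ (ind (P 2))) * (ex μ (ind (P 0)) * (ex μ (ind (Q 1)) - ex μ (ind (P 1)))
                                    + ex μ (ind (P 1)) * (ex μ (ind (Q 0)) - ex μ (ind (P 0))))
        - (ex μ (ind (Q 0)) - ex μ (ind (P 0))) * (ex μ (ind (Q 1)) - ex μ (ind (P 1))) * (ex μ (ind (Q 2)) - ex μ (ind (P 2)))
      = (ex μ (ind (Q 0)) - ex μ (ind (P 0))) * (ex μ (ind (Q 1) * ind (Q 2)) - ex μ (ind (Q 1)) * ex μ (ind (Q 2)))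
        + (ex μ (ind (Q 1)) - ex μ (ind (P 1))) * (ex μ (ind (Q 0) * ind (Q 2)) - ex μ (ind (Q 0)) * ex μ (ind (Q 2)))
        + (ex μ (ind (Q 2)) - ex μ (ind (P 2))) * (ex μ (ind (Q 0) * ind (Q 1)) - ex μ (ind (Q 0)) * ex μ (ind (Q 1)))
        + ex μ (ind (P 2)) * (ex μ (ind (Q 0)) - ex μ (ind (P 0))) * (ex μ (ind (Q 1)) - ex μ (ind (P 1)))
        + ex μ (ind (Q 1)) * (ex μ (ind (Q 0)) - ex μ (ind (P 0))) * (ex μ (ind (Q 2)) - ex μ (ind (P 2)))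
        + ex μ (ind (P 0)) * (ex μ (ind (Q 1)) - ex μ (ind (P 1))) * (ex μ (ind (Q 2)) - ex μ (ind (P 2)))
        - (κ - ex μ (ind (P 2))) * (ex μ (ind (P 0)) * (ex μ (ind (Q 1)) - ex μ (ind (P 1)))
                                    + ex μ (ind (P 1)) * (ex μ (ind (Q 0)) - ex μ (ind (P 0)))) := by
  ring

end Identity

/-! ### 2. The conditional reduction for an increasing triple -/

/-- **D0_3(2) from `Ψ ≥ 0` and `C_3` of the 1-minor.**  Let `U` be an increasing triple whose `0`-minor `P = U^{e←0}` satisfies the four sandwich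
moment relations at `μ_p` (e.g. `P ∈ Z_3`, `…Sandwich`), and `Q = U^{e←1}`.  If `Ψ ≥ 0` and `E_3(μ_p; 1_Q) ≥ 0` then `MD_3` holds at `(U, e, p)`:
`(1−p_e)²·E_3(U^{e←0}) + p_e²·E_3(U^{e←1}) ≤ E_3(U)` (the first summand is `0` here). [this work] -/
theorem sahiE_three_ge_sq_minor_of_psi_nonneg (p : ι → unitInterval) (e : ι) (U : Fin 3 → Set (Set ι)) (hU : ∀ j, IsUpperSet (U j)) (κ : ℝ)
    (h1 : ex (bernoulliWeight p) (ind (secAt e false (U 0)) * ind (secAt e false (U 1)))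
      = ex (bernoulliWeight p) (ind (secAt e false (U 0))) * ex (bernoulliWeight p) (ind (secAt e false (U 1))))
    (h2 : ex (bernoulliWeight p) (ind (secAt e false (U 0)) * ind (secAt e false (U 2))) = κ * ex (bernoulliWeight p) (ind (secAt e false (U 0))))
    (h3 : ex (bernoulliWeight p) (ind (secAt e false (U 1)) * ind (secAt e false (U 2))) = κ * ex (bernoulliWeight p) (ind (secAt e false (U 1))))
    (h4 : ex (bernoulliWeight p) (ind (secAt e false (U 0)) * ind (secAt e false (U 1)) * ind (secAt e false (U 2)))
      = κ * ex (bernoulliWeight p) (ind (secAt e false (U 0))) * ex (bernoulliWeight p) (ind (secAt e false (U 1))))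
    (hPsi : 0 ≤
      (ex (bernoulliWeight p) (ind (secAt e true (U 0))) - ex (bernoulliWeight p) (ind (secAt e false (U 0))))
          * (ex (bernoulliWeight p) (ind (secAt e true (U 1)) * ind (secAt e true (U 2)))
              - ex (bernoulliWeight p) (ind (secAt e true (U 1))) * ex (bernoulliWeight p) (ind (secAt e true (U 2))))
        + (ex (bernoulliWeight p) (ind (secAt e true (U 1))) - ex (bernoulliWeight p) (ind (secAt e false (U 1))))
          * (ex (bernoulliWeight p) (ind (secAt e true (U 0)) * ind (secAt e true (U 2)))
              - ex (bernoulliWeight p) (ind (secAt e false (U 0))) * ex (bernoulliWeight p) (ind (secAt e true (U 2))))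
        + (ex (bernoulliWeight p) (ind (secAt e true (U 2))) - ex (bernoulliWeight p) (ind (secAt e false (U 2))))
          * (ex (bernoulliWeight p) (ind (secAt e true (U 0)) * ind (secAt e true (U 1)))
              - ex (bernoulliWeight p) (ind (secAt e false (U 0))) * ex (bernoulliWeight p) (ind (secAt e false (U 1))))
        - (κ - ex (bernoulliWeight p) (ind (secAt e false (U 2))))
          * (ex (bernoulliWeight p) (ind (secAt e false (U 0)))
              * (ex (bernoulliWeight p) (ind (secAt e true (U 1))) - ex (bernoulliWeight p) (ind (secAt e false (U 1))))
            + ex (bernoulliWeight p) (ind (secAt e false (U 1)))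
              * (ex (bernoulliWeight p) (ind (secAt e true (U 0))) - ex (bernoulliWeight p) (ind (secAt e false (U 0)))))
        - (ex (bernoulliWeight p) (ind (secAt e true (U 0))) - ex (bernoulliWeight p) (ind (secAt e false (U 0))))
          * (ex (bernoulliWeight p) (ind (secAt e true (U 1))) - ex (bernoulliWeight p) (ind (secAt e false (U 1))))
          * (ex (bernoulliWeight p) (ind (secAt e true (U 2))) - ex (bernoulliWeight p) (ind (secAt e false (U 2)))))
    (hE1 : 0 ≤ sahiE (bernoulliWeight p) 3 (fun j => ind (secAt e true (U j)))) :
    (1 - (p e : ℝ)) ^ 2 * sahiE (bernoulliWeight p) 3 (fun j => ind (secAt e false (U j)))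
      + (p e : ℝ) ^ 2 * sahiE (bernoulliWeight p) 3 (fun j => ind (secAt e true (U j)))
      ≤ sahiE (bernoulliWeight p) 3 (fun j => ind (U j)) := by
  refine sahiE_three_ge_sq_minors_of_mixC2_ge e U hU p ?_
  have h := mixC2_sub_sahiE_eq_sahiE_add_psi (bernoulliWeight p) (fun j => secAt e false (U j)) (fun j => secAt e true (U j)) κ h1 h2 h3 h4
  linarith

end Pointwise

end Summit.CriticalPhenomena.PercolationContinuityZ3.Theorems

end
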